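import Literature.Topology.FourManifolds.PlanarPage
import Literature.Topology.FourManifolds.RegularLevelSplitting
import HarnessLib

/-!
# The smooth oriented model planar page: `P_n` as a regular sublevel set in `𝔼²`

Topic `Literature/Topology/FourManifolds` (general mathematics; definitions and elementary lemmas,
nothing asserted).  Brick D-b0 of the vocabulary programme G3 recorded in
`Summits/SmoothPoincare4/SmoothPoincare4/Cruxes/PlanarAcyclicBisectionRigidity/DictionaryDesign.md`
(crux `stmt-SmoothPoincare4-15086`, line `Sketch`): the planar Lefschetz bodies of the dictionary
(D-b, a thin specialisation of `Literature.Topology.FourManifolds.IsLefschetzHandlebodyOver`,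
`AchiralLefschetzModel.lean`) need the PAGE as a smooth compact ORIENTED surface with boundary
(`ChartedSpace (EuclideanHalfSpace 2)`, `IsManifold (𝓡∂ 2) ∞`, `SmoothOrientation (𝓡∂ 2)`)
together with a homeomorphism to the topological model page `PlanarPage n` of `PlanarPage.lean`
(brick D0), where the lassos and `wordClass` live.  This file builds exactly that, with proofs.

**Construction.**  Transport `pageSet n ⊂ ℂ` to `𝔼² = EuclideanSpace ℝ (Fin 2)` by the isometry
`Complex.orthonormalBasisOneI.repr : ℂ ≃ₗᵢ[ℝ] 𝔼²` (`PlanarPage.pageSetE`, `image_repr_pageSet`).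
With `ρ = holeRadius n`, `c_j = centreE n j`, put (`PlanarPage.levelFun`)
`F(p) = -ρ² + χ₀(p) (‖p‖² - 1 + ρ²) + Σ_j χ_j(p) (2ρ² - ‖p - c_j‖²)`, with cutoffs
`χ₀, χ_j ∈ [0, 1]` from `Real.smoothTransition`: `χ₀ = 1` on `‖p‖ ≥ 1 - ρ`, `= 0` on
`‖p‖ ≤ 1 - 2ρ`; `χ_j = 1` on `‖p - c_j‖ ≤ 2ρ`, `= 0` on `‖p - c_j‖ ≥ 3ρ`.  As `‖c_j‖ ≤ 1 - 8ρ` and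
`‖c_j - c_k‖ ≥ 8ρ`, the collars are pairwise disjoint, so `F = ‖p‖² - 1` near the unit circle,
`F = ρ² - ‖p - c_j‖²` near the `j`-th hole circle, and `F < 0` at all other points of the page.
Hence `{F ≤ 0} = pageSetE n` (`levelFun_le_zero_iff`), `{F = 0}` is the union of the `n + 1`
boundary circles (`levelFun_eq_zero_iff`), and `0` is a regular value (`isRegularLevel_levelFun`:
gradient `2p`, resp. `-2(p - c_j)`).  The smooth page `SmoothPlanarPage n` is the regular
sublevel set `RegularSublevel (isRegularLevel_levelFun n)` (Milnor, *Morse theory* (1963),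
Thm. 3.1, as formalised in `RegularLevelSplitting.lean`): compact, nonempty, oriented from the
standard orientation of `𝔼²` (`SmoothPlanarPage.orientation`), homeomorphic to `PlanarPage n`
(`toPlanarPage`), with interior `{‖p‖ < 1, ‖p - c_j‖ > ρ}` (`mem_interior_iff`).

## References
* J. Milnor, *Morse theory*, Ann. of Math. Studies 51 (1963), §3, Thm. 3.1. [Milnor1963]
* B. Farb, D. Margalit, *A Primer on Mapping Class Groups*, Princeton Math. Ser. 49 (2012), §1.3
  (the disc `D_n`). [FarbMargalit2012]
-/

open scoped Manifold ContDiff Topology InnerProductSpace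
open Set Function Filter Metric Module

noncomputable section

namespace Literature.Topology.FourManifolds

namespace PlanarPage

variable {n : ℕ} {p : EuclideanSpace ℝ (Fin 2)}

/-- The centre `c_j` of hole `j` as a point of `𝔼²` (via the identification `ℂ ≅ 𝔼²`). [folklore] -/
def centreE (n : ℕ) (j : Fin n) : EuclideanSpace ℝ (Fin 2) :=
  Complex.orthonormalBasisOneI.repr (holeCentre n j : ℂ)

/-- The model page in `𝔼²`: the closed unit disc minus `n` open round holes of radius `ρ` about
the `c_j`. [cite: FarbMargalit2012, §1.3] -/
def pageSetE (n : ℕ) : Set (EuclideanSpace ℝ (Fin 2)) :=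
  {p | ‖p‖ ≤ 1 ∧ ∀ j : Fin n, holeRadius n ≤ ‖p - centreE n j‖}

/-- The isometry `ℂ ≅ 𝔼²` carries `pageSet n` onto `pageSetE n`. [folklore] -/
theorem image_repr_pageSet : Complex.orthonormalBasisOneI.repr '' pageSet n = pageSetE n := by
  have he : ∀ q (c : ℂ), ‖Complex.orthonormalBasisOneI.repr.symm q - c‖ =
      ‖q - Complex.orthonormalBasisOneI.repr c‖ := fun q c => by
    rw [← Complex.orthonormalBasisOneI.repr.symm.norm_map, map_sub,
      LinearIsometryEquiv.symm_apply_apply]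
  ext q
  rw [← Complex.orthonormalBasisOneI.repr.apply_symm_apply q,
    Complex.orthonormalBasisOneI.repr.injective.mem_set_image]
  simp only [pageSet, pageSetE, mem_setOf_eq, LinearIsometryEquiv.norm_map, he, centreE,
    LinearIsometryEquiv.apply_symm_apply]

/-- `8ρ = 2/(n+1)`. [folklore] -/
theorem eight_mul_holeRadius (n : ℕ) : 8 * holeRadius n = 2 / (n + 1) := by
  unfold holeRadius; field_simp; norm_num

/-- `ρ ≤ 1/4`. [folklore] -/
theorem holeRadius_le_quarter (n : ℕ) : holeRadius n ≤ 1 / 4 :=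
  one_div_le_one_div_of_le (by norm_num) (by linarith [n.cast_nonneg (α := ℝ)])

/-- `‖c_j‖ ≤ 1 - 8ρ`: the holes stay `8ρ` inside the unit circle. [folklore] -/
theorem norm_centreE_le (j : Fin n) : ‖centreE n j‖ ≤ 1 - 8 * holeRadius n := by
  rw [centreE, LinearIsometryEquiv.norm_map, Complex.norm_real, Real.norm_eq_abs,
    eight_mul_holeRadius]
  exact abs_holeCentre_le j

/-- Distinct hole centres are `≥ 8ρ` apart. [folklore] -/
theorem le_norm_centreE_sub {j k : Fin n} (h : j ≠ k) :
    8 * holeRadius n ≤ ‖centreE n j - centreE n k‖ := by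
  rw [centreE, centreE, ← map_sub, LinearIsometryEquiv.norm_map, ← Complex.ofReal_sub,
    Complex.norm_real, Real.norm_eq_abs, eight_mul_holeRadius]
  exact two_div_le_abs_holeCentre_sub h

/-- In the outer collar `1 - 2ρ < ‖p‖` one is `> 6ρ` away from every hole centre. [folklore] -/
theorem lt_norm_sub_centreE_of_outer (hp : 1 - 2 * holeRadius n < ‖p‖) (j : Fin n) :
    6 * holeRadius n < ‖p - centreE n j‖ := by
  linarith [norm_centreE_le j, norm_sub_norm_le p (centreE n j)]

/-- In the collar `‖p - c_j‖ < 3ρ` of hole `j` one has `‖p‖ < 1 - 5ρ`. [folklore] -/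
theorem norm_lt_of_hole {j : Fin n} (hp : ‖p - centreE n j‖ < 3 * holeRadius n) :
    ‖p‖ < 1 - 5 * holeRadius n := by
  linarith [norm_centreE_le j, norm_le_norm_sub_add p (centreE n j)]

/-- In the collar of hole `j` one is `> 5ρ` away from every other hole centre. [folklore] -/
theorem lt_norm_sub_centreE_of_hole {j k : Fin n}
    (hp : ‖p - centreE n j‖ < 3 * holeRadius n) (hk : k ≠ j) :
    5 * holeRadius n < ‖p - centreE n k‖ := by
  linarith [le_norm_centreE_sub hk, norm_sub_rev (centreE n k) p,
    norm_sub_le_norm_sub_add_norm_sub (centreE n k) p (centreE n j)]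

/-- The smooth ramp `smoothTransition ((x - a)/(b - a)) ∈ [0, 1]`: for `a < b` it is `0` on
`x ≤ a` and `1` on `b ≤ x`. [folklore] -/
def smoothRamp (a b x : ℝ) : ℝ := Real.smoothTransition ((x - a) / (b - a))

/-- The smooth ramp vanishes below `a`. [folklore] -/
theorem smoothRamp_eq_zero {a b x : ℝ} (hab : a < b) (hx : x ≤ a) : smoothRamp a b x = 0 :=
  Real.smoothTransition.zero_of_nonpos
    (div_nonpos_iff.2 (Or.inr ⟨sub_nonpos.2 hx, (sub_pos.2 hab).le⟩))

/-- The smooth ramp is `1` above `b`. [folklore] -/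
theorem smoothRamp_eq_one {a b x : ℝ} (hab : a < b) (hx : b ≤ x) : smoothRamp a b x = 1 :=
  Real.smoothTransition.one_of_one_le ((one_le_div₀ (sub_pos.2 hab)).2 (sub_le_sub_right hx a))

/-- The smooth ramp is `C^∞`. [folklore] -/
theorem contDiff_smoothRamp (a b : ℝ) : ContDiff ℝ ∞ (smoothRamp a b) :=
  Real.smoothTransition.contDiff.comp ((contDiff_id.sub contDiff_const).div_const _)

/-- The outer cutoff `χ₀(p)`: `0` on `‖p‖ ≤ 1 - 2ρ`, `1` on `‖p‖ ≥ 1 - ρ`. [folklore] -/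
def cutOuter (n : ℕ) (p : EuclideanSpace ℝ (Fin 2)) : ℝ :=
  smoothRamp ((1 - 2 * holeRadius n) ^ 2) ((1 - holeRadius n) ^ 2) (‖p‖ ^ 2)

/-- The cutoff `χ_j(p)` of hole `j`: `1` on `‖p - c_j‖ ≤ 2ρ`, `0` on `‖p - c_j‖ ≥ 3ρ`. [folklore] -/
def cutHole (n : ℕ) (j : Fin n) (p : EuclideanSpace ℝ (Fin 2)) : ℝ :=
  1 - smoothRamp ((2 * holeRadius n) ^ 2) ((3 * holeRadius n) ^ 2) (‖p - centreE n j‖ ^ 2)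

/-- `χ₀ = 0` on `‖p‖ ≤ 1 - 2ρ`. [folklore] -/
theorem cutOuter_eq_zero (hp : ‖p‖ ≤ 1 - 2 * holeRadius n) : cutOuter n p = 0 := by
  obtain ⟨hρ, hρ4⟩ := And.intro (holeRadius_pos n) (holeRadius_le_quarter n)
  exact smoothRamp_eq_zero (by nlinarith) (pow_le_pow_left₀ (norm_nonneg _) hp 2)

/-- `χ₀ = 1` on `1 - ρ ≤ ‖p‖`. [folklore] -/
theorem cutOuter_eq_one (hp : 1 - holeRadius n ≤ ‖p‖) : cutOuter n p = 1 := by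
  obtain ⟨hρ, hρ4⟩ := And.intro (holeRadius_pos n) (holeRadius_le_quarter n)
  exact smoothRamp_eq_one (by nlinarith) (pow_le_pow_left₀ (by linarith) hp 2)

/-- `χ_j = 1` on `‖p - c_j‖ ≤ 2ρ`. [folklore] -/
theorem cutHole_eq_one {j : Fin n} (hp : ‖p - centreE n j‖ ≤ 2 * holeRadius n) :
    cutHole n j p = 1 := by
  rw [cutHole, smoothRamp_eq_zero (by nlinarith [holeRadius_pos n])
    (pow_le_pow_left₀ (norm_nonneg _) hp 2), sub_zero]

/-- `χ_j = 0` on `3ρ ≤ ‖p - c_j‖`. [folklore] -/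
theorem cutHole_eq_zero {j : Fin n} (hp : 3 * holeRadius n ≤ ‖p - centreE n j‖) :
    cutHole n j p = 0 := by
  have hρ := holeRadius_pos n
  rw [cutHole, smoothRamp_eq_one (by nlinarith) (pow_le_pow_left₀ (by positivity) hp 2), sub_self]

/-- **The level function of the page**, smooth on `𝔼²` with `{F ≤ 0}` the page and `0` a
regular value: `F(p) = -ρ² + χ₀(p) (‖p‖² - 1 + ρ²) + Σ_j χ_j(p) (2ρ² - ‖p - c_j‖²)`. [folklore] -/
def levelFun (n : ℕ) (p : EuclideanSpace ℝ (Fin 2)) : ℝ :=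
  -holeRadius n ^ 2 + cutOuter n p * (‖p‖ ^ 2 - 1 + holeRadius n ^ 2) +
    ∑ j : Fin n, cutHole n j p * (2 * holeRadius n ^ 2 - ‖p - centreE n j‖ ^ 2)

/-- **`F` is smooth.** [folklore] -/
theorem contDiff_levelFun : ContDiff ℝ ∞ (levelFun n) := by
  have hsq : ContDiff ℝ ∞ fun q : EuclideanSpace ℝ (Fin 2) => ‖q‖ ^ 2 := contDiff_norm_sq ℝ
  have hd : ∀ j, ContDiff ℝ ∞ fun q : EuclideanSpace ℝ (Fin 2) => ‖q - centreE n j‖ ^ 2 :=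
    fun j => hsq.comp (contDiff_id.sub contDiff_const)
  unfold levelFun cutOuter cutHole
  exact (contDiff_const.add (((contDiff_smoothRamp _ _).comp hsq).mul ((hsq.sub contDiff_const).add
    contDiff_const))).add (ContDiff.sum fun j _ =>
      (contDiff_const.sub ((contDiff_smoothRamp _ _).comp (hd j))).mul (contDiff_const.sub (hd j)))

/-- In the outer collar `1 - 2ρ < ‖p‖` every hole term vanishes. [folklore] -/
theorem levelFun_eq_of_outer (hp : 1 - 2 * holeRadius n < ‖p‖) :
    levelFun n p = -holeRadius n ^ 2 + cutOuter n p * (‖p‖ ^ 2 - 1 + holeRadius n ^ 2) := by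
  refine (add_eq_left.2 (Finset.sum_eq_zero fun j _ => ?_)).trans rfl
  rw [cutHole_eq_zero (by linarith [holeRadius_pos n, lt_norm_sub_centreE_of_outer hp j]),
    zero_mul]

/-- In the collar `‖p - c_j‖ < 3ρ` of hole `j` only the `j`-th term survives. [folklore] -/
theorem levelFun_eq_of_hole {j : Fin n} (hp : ‖p - centreE n j‖ < 3 * holeRadius n) :
    levelFun n p =
      -holeRadius n ^ 2 + cutHole n j p * (2 * holeRadius n ^ 2 - ‖p - centreE n j‖ ^ 2) := by
  have hρ := holeRadius_pos n
  rw [levelFun, cutOuter_eq_zero (by linarith [norm_lt_of_hole hp]), zero_mul, add_zero,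
    Finset.sum_eq_single j (fun k _ hk => ?_) (fun h => absurd (Finset.mem_univ j) h)]
  rw [cutHole_eq_zero (by linarith [lt_norm_sub_centreE_of_hole hp hk]), zero_mul]

/-- Off all collars the level function is the constant `-ρ²`. [folklore] -/
theorem levelFun_eq_of_far (h0 : ‖p‖ ≤ 1 - 2 * holeRadius n)
    (hj : ∀ j, 3 * holeRadius n ≤ ‖p - centreE n j‖) : levelFun n p = -holeRadius n ^ 2 := by
  rw [levelFun, cutOuter_eq_zero h0, zero_mul, add_zero, add_eq_left]
  exact Finset.sum_eq_zero fun j _ => by rw [cutHole_eq_zero (hj j), zero_mul]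

/-- On `1 - ρ ≤ ‖p‖` the level function is `‖p‖² - 1`. [folklore] -/
theorem levelFun_eq_norm_sq_sub (hp : 1 - holeRadius n ≤ ‖p‖) :
    levelFun n p = ‖p‖ ^ 2 - 1 := by
  rw [levelFun_eq_of_outer (by linarith [holeRadius_pos n]), cutOuter_eq_one hp]
  ring

/-- On `‖p - c_j‖ ≤ 2ρ` the level function is `ρ² - ‖p - c_j‖²`. [folklore] -/
theorem levelFun_eq_sq_sub_norm_sq {j : Fin n}
    (hp : ‖p - centreE n j‖ ≤ 2 * holeRadius n) :
    levelFun n p = holeRadius n ^ 2 - ‖p - centreE n j‖ ^ 2 := by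
  rw [levelFun_eq_of_hole (by linarith [holeRadius_pos n]), cutHole_eq_one hp]
  ring

/-- **Sign of `F`**: `F ≤ 0` exactly on the page, `F = 0` exactly on its boundary circles.
[folklore] -/
theorem levelFun_sign : (levelFun n p ≤ 0 ↔ p ∈ pageSetE n) ∧
    (levelFun n p = 0 ↔ ‖p‖ = 1 ∨ ∃ j, ‖p - centreE n j‖ = holeRadius n) := by
  obtain ⟨hρ, hρ4⟩ := And.intro (holeRadius_pos n) (holeRadius_le_quarter n)
  have key : levelFun n p < 0 → ‖p‖ < 1 → (∀ j, holeRadius n < ‖p - centreE n j‖) →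
      (levelFun n p ≤ 0 ↔ p ∈ pageSetE n) ∧
        (levelFun n p = 0 ↔ ‖p‖ = 1 ∨ ∃ j, ‖p - centreE n j‖ = holeRadius n) :=
    fun hF h1 hj => ⟨iff_of_true hF.le ⟨h1.le, fun j => (hj j).le⟩,
      iff_of_false hF.ne (by rintro (h | ⟨j, h⟩) <;> [exact h1.ne h; exact (hj j).ne' h])⟩
  by_cases h0 : 1 - 2 * holeRadius n < ‖p‖
  · have hfar : ∀ j, holeRadius n < ‖p - centreE n j‖ := fun j => by
      linarith [lt_norm_sub_centreE_of_outer h0 j]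
    by_cases h1 : 1 - holeRadius n ≤ ‖p‖
    · rw [levelFun_eq_norm_sq_sub h1]
      have hp0 : 0 ≤ ‖p‖ := norm_nonneg p
      refine ⟨⟨fun h => ⟨by nlinarith, fun j => (hfar j).le⟩, fun h => by nlinarith [h.1]⟩,
        ⟨fun h => Or.inl (le_antisymm (by nlinarith) (by nlinarith)), ?_⟩⟩
      rintro (h | ⟨j, hj⟩)
      · rw [h]; ring
      · exact absurd hj (hfar j).ne'
    · push Not at h1
      refine key ?_ (by linarith) hfar
      rw [levelFun_eq_of_outer h0]
      have hlt : ‖p‖ ^ 2 - 1 + holeRadius n ^ 2 < 0 := by nlinarith [norm_nonneg p]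
      have hle : cutOuter n p * (‖p‖ ^ 2 - 1 + holeRadius n ^ 2) ≤ 0 :=
        mul_nonpos_iff.2 (Or.inl ⟨Real.smoothTransition.nonneg _, hlt.le⟩)
      linarith [pow_pos hρ 2]
  push Not at h0
  by_cases hj : ∃ j, ‖p - centreE n j‖ < 3 * holeRadius n
  · obtain ⟨j, hj⟩ := hj
    have hn1 : ‖p‖ < 1 := by linarith [norm_lt_of_hole hj]
    have hoth : ∀ k, k ≠ j → holeRadius n < ‖p - centreE n k‖ := fun k hk => by
      linarith [lt_norm_sub_centreE_of_hole hj hk]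
    by_cases h1 : ‖p - centreE n j‖ ≤ 2 * holeRadius n
    · rw [levelFun_eq_sq_sub_norm_sq h1]
      have ht0 : 0 ≤ ‖p - centreE n j‖ := norm_nonneg _
      refine ⟨⟨fun h => ⟨hn1.le, fun k => ?_⟩, fun h => by nlinarith [h.2 j]⟩,
        ⟨fun h => Or.inr ⟨j, le_antisymm (by nlinarith) (by nlinarith)⟩, ?_⟩⟩
      · by_cases hkj : k = j
        · subst hkj; nlinarith
        · exact (hoth k hkj).le
      · rintro (h | ⟨k, hk⟩)
        · exact absurd h hn1.ne
        · by_cases hkj : k = j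
          · subst hkj; rw [hk]; ring
          · exact absurd hk (hoth k hkj).ne'
    · push Not at h1
      refine key ?_ hn1 fun k => ?_
      · rw [levelFun_eq_of_hole hj]
        have hlt : 2 * holeRadius n ^ 2 - ‖p - centreE n j‖ ^ 2 < 0 := by nlinarith
        have hle : cutHole n j p * (2 * holeRadius n ^ 2 - ‖p - centreE n j‖ ^ 2) ≤ 0 :=
          mul_nonpos_iff.2 (Or.inl ⟨sub_nonneg.2 (Real.smoothTransition.le_one _), hlt.le⟩)
        linarith [pow_pos hρ 2]
      · by_cases hkj : k = j
        · subst hkj; linarith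
        · exact hoth k hkj
  · push Not at hj
    exact key (by rw [levelFun_eq_of_far h0 hj]; exact neg_lt_zero.2 (pow_pos hρ 2))
      (by linarith) fun j => by linarith [hj j]

/-- **The sublevel set `{F ≤ 0}` is exactly the page.** [folklore] -/
theorem levelFun_le_zero_iff : levelFun n p ≤ 0 ↔ p ∈ pageSetE n :=
  levelFun_sign.1

/-- **The zero set `{F = 0}` is the union of the `n + 1` boundary circles.** [folklore] -/
theorem levelFun_eq_zero_iff :
    levelFun n p = 0 ↔ ‖p‖ = 1 ∨ ∃ j, ‖p - centreE n j‖ = holeRadius n :=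
  levelFun_sign.2

/-- The differential of `F` at a point of the unit circle is `2⟨p, ·⟩`. [folklore] -/
theorem hasFDerivAt_levelFun_of_norm_eq_one (hp : ‖p‖ = 1) :
    HasFDerivAt (levelFun n) (2 • innerSL ℝ p) p := by
  have hlt : 1 - holeRadius n < ‖p‖ := by linarith [holeRadius_pos n]
  have hev : levelFun n =ᶠ[𝓝 p] fun q => ‖q‖ ^ 2 - 1 :=
    (continuous_norm.continuousAt.eventually (lt_mem_nhds hlt)).mono
      fun q hq => levelFun_eq_norm_sq_sub (le_of_lt hq)
  exact ((hasStrictFDerivAt_norm_sq p).hasFDerivAt.sub_const 1).congr_of_eventuallyEq hev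

/-- The differential of `F` at a point of the `j`-th hole circle is `-2⟨p - c_j, ·⟩`. [folklore] -/
theorem hasFDerivAt_levelFun_of_norm_sub_eq {j : Fin n}
    (hp : ‖p - centreE n j‖ = holeRadius n) :
    HasFDerivAt (levelFun n) (-(2 • innerSL ℝ (p - centreE n j))) p := by
  have hlt : ‖p - centreE n j‖ < 2 * holeRadius n := by linarith [holeRadius_pos n]
  have hev : levelFun n =ᶠ[𝓝 p] fun q => holeRadius n ^ 2 - ‖q - centreE n j‖ ^ 2 :=
    (((continuous_id.sub continuous_const).norm).continuousAt.eventually (gt_mem_nhds hlt)).mono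
      fun q hq => levelFun_eq_sq_sub_norm_sq (le_of_lt hq)
  have h1 : HasFDerivAt (fun q : EuclideanSpace ℝ (Fin 2) => ‖q - centreE n j‖ ^ 2)
      (2 • innerSL ℝ (p - centreE n j)) p := by
    simpa using ((hasFDerivAt_id p).sub_const (centreE n j)).norm_sq
  exact (h1.const_sub _).congr_of_eventuallyEq hev

/-- **`0` is a regular value of `F`** (`𝔼²` has no boundary, and at a zero of `F` the
differential is `2⟨p, ·⟩ ≠ 0`, resp. `-2⟨p - c_j, ·⟩ ≠ 0`). [cite: Milnor1963, Thm. 3.1] -/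
theorem isRegularLevel_levelFun (n : ℕ) : IsRegularLevel (𝓡 2) (levelFun n) 0 := by
  refine isRegularLevel_of_not_isMCriticalPt contDiff_levelFun.contMDiff fun p hp hc => ?_
  have hc' : fderiv ℝ (levelFun n) p = 0 := by rwa [IsMCriticalPt, mfderiv_eq_fderiv] at hc
  rcases levelFun_eq_zero_iff.1 hp with h1 | ⟨j, hj⟩
  · have hd := DFunLike.congr_fun (hasFDerivAt_levelFun_of_norm_eq_one (n := n) h1).fderiv p
    rw [hc', zero_apply, smul_apply, innerSL_apply_apply, real_inner_self_eq_norm_sq, h1] at hd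
    norm_num at hd
  · have hd :=
      DFunLike.congr_fun (hasFDerivAt_levelFun_of_norm_sub_eq hj).fderiv (p - centreE n j)
    rw [hc', zero_apply, neg_apply, smul_apply, innerSL_apply_apply, real_inner_self_eq_norm_sq,
      hj] at hd
    simp [(holeRadius_pos n).ne'] at hd

/-- **`{F ≤ 0}` is compact** (closed, and inside the closed unit disc). [folklore] -/
theorem isCompact_preimage_levelFun (n : ℕ) : IsCompact (levelFun n ⁻¹' Iic 0) :=
  (ProperSpace.isCompact_closedBall (0 : EuclideanSpace ℝ (Fin 2)) 1).of_isClosed_subset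
    (isClosed_Iic.preimage contDiff_levelFun.continuous)
    fun _ hp => by simpa using (levelFun_le_zero_iff.1 hp).1

end PlanarPage

/-- **The smooth model planar page `P_n`**: the disc with `n` round holes as the regular
sublevel set `{F ≤ 0} ⊂ 𝔼²` of `PlanarPage.levelFun n`, a compact `C^∞` surface with boundary
(`RegularSublevel`; Milnor 1963, Thm. 3.1: `Mᵃ = f⁻¹(-∞, a]` is a smooth manifold with boundary
`f⁻¹(a)`). [cite: Milnor1963, Thm. 3.1] -/
abbrev SmoothPlanarPage (n : ℕ) : Type :=
  RegularSublevel (PlanarPage.isRegularLevel_levelFun n)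

namespace SmoothPlanarPage

open PlanarPage
variable {n : ℕ}

/-- The smooth page is compact. [folklore] -/
instance instCompactSpace (n : ℕ) : CompactSpace (SmoothPlanarPage n) :=
  isCompact_iff_compactSpace.1 (isCompact_preimage_levelFun n)

/-- The smooth page is nonempty (it contains the unit circle). [folklore] -/
instance instNonempty (n : ℕ) : Nonempty (SmoothPlanarPage n) :=
  ⟨RegularSublevel.mk _ (Complex.orthonormalBasisOneI.repr (1 : ℂ))
    (levelFun_eq_zero_iff.2 (Or.inl (by rw [LinearIsometryEquiv.norm_map, norm_one]))).le⟩

/-- **The orientation of the smooth page** induced from the standard orientation of `𝔼²`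
(`RegularSublevel.orientation`: pullback along the inclusion). [folklore] -/
def orientation (n : ℕ) : SmoothOrientation (𝓡∂ 2) (SmoothPlanarPage n) :=
  RegularSublevel.orientation _ (SmoothOrientation.euclidean 2)

/-- **The smooth page is homeomorphic to the topological page `PlanarPage n`** (via `𝔼² ≅ ℂ`).
[folklore] -/
def toPlanarPage (n : ℕ) : SmoothPlanarPage n ≃ₜ PlanarPage n where
  toFun p := ⟨Complex.orthonormalBasisOneI.repr.symm (RegularSublevel.incl _ p), by
    rw [← Complex.orthonormalBasisOneI.repr.injective.mem_set_image,
      LinearIsometryEquiv.apply_symm_apply, image_repr_pageSet]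
    exact levelFun_le_zero_iff.1 (RegularSublevel.apply_incl_le _ p)⟩
  invFun z := RegularSublevel.mk _ (Complex.orthonormalBasisOneI.repr (z : ℂ))
    (levelFun_le_zero_iff.2 (by rw [← image_repr_pageSet]; exact mem_image_of_mem _ z.2))
  left_inv p :=
    RegularSublevel.injective_incl _ (Complex.orthonormalBasisOneI.repr.apply_symm_apply _)
  right_inv z := Subtype.ext (Complex.orthonormalBasisOneI.repr.symm_apply_apply _)
  continuous_toFun := (Complex.orthonormalBasisOneI.repr.symm.continuous.comp
    (RegularSublevel.continuous_incl _)).subtype_mk _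
  continuous_invFun := (RegularSublevel.isEmbedding_incl _).continuous_iff.2
    (Complex.orthonormalBasisOneI.repr.continuous.comp continuous_subtype_val)

/-- The homeomorphism on points: `p ↦ repr⁻¹ p`. [folklore] -/
@[simp] theorem coe_toPlanarPage (p : SmoothPlanarPage n) :
    ((toPlanarPage n p : PlanarPage n) : ℂ) =
      Complex.orthonormalBasisOneI.repr.symm (RegularSublevel.incl _ p) := rfl

/-- **The interior of the smooth page** is `{‖p‖ < 1, ‖p - c_j‖ > ρ ∀ j}`.
[cite: Milnor1963, Thm. 3.1] -/
theorem mem_interior_iff (p : SmoothPlanarPage n) :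
    p ∈ (𝓡∂ 2).interior (SmoothPlanarPage n) ↔
      ‖RegularSublevel.incl _ p‖ < 1 ∧
        ∀ j, holeRadius n < ‖RegularSublevel.incl _ p - PlanarPage.centreE n j‖ := by
  refine (RegularSublevel.isInteriorPoint_iff _ p).trans ?_
  have hq : RegularSublevel.incl _ p ∈ pageSetE n :=
    levelFun_le_zero_iff.1 (RegularSublevel.apply_incl_le _ p)
  rw [(RegularSublevel.apply_incl_le _ p).lt_iff_ne, Ne, levelFun_eq_zero_iff, not_or, not_exists]
  exact ⟨fun h => ⟨hq.1.lt_of_ne h.1, fun j => (hq.2 j).lt_of_ne (Ne.symm (h.2 j))⟩,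
    fun h => ⟨h.1.ne, fun j => (h.2 j).ne'⟩⟩

/-- **The boundary of the smooth page**: the unit circle and the `n` hole circles.
[cite: Milnor1963, Thm. 3.1] -/
theorem mem_boundary_iff (p : SmoothPlanarPage n) :
    p ∈ (𝓡∂ 2).boundary (SmoothPlanarPage n) ↔
      ‖RegularSublevel.incl _ p‖ = 1 ∨
        ∃ j, ‖RegularSublevel.incl _ p - PlanarPage.centreE n j‖ = holeRadius n :=
  (RegularSublevel.mem_boundary_iff _ p).trans levelFun_eq_zero_iff

end SmoothPlanarPage

end Literature.Topology.FourManifolds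

end
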